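import Summits.CriticalPhenomena.PercolationContinuityZ3.Theorems.PercNearOneGluingNoHeavyPcintProductResampling
import Summits.CriticalPhenomena.PercolationContinuityZ3.Theorems.PercNearOneGluingNoHeavyPcintVdBEFibreBasic
import Summits.CriticalPhenomena.PercolationContinuityZ3.Theorems.PercNearOneGluingNoHeavyPcintVdBETableBridge
import HarnessLib

/-!
# PCINT lane, king route, K1 step (3b): positions, local offsets, and the table's factors as real numbers

Cell `prim-pcint`, seat `prim-pcint-1` (gen 10); memo `run/shared/lean/prim/pcint/KING-ROUTE.md` §K1 (3)/(4).

Bookkeeping between the sites of a finite `Λ ⊆ ℤ²` and the relative positions `VdBELocal.Pos = ℤ × ℤ` of the kernel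
tables (`…PcintVdBEDominance.lean`):

* `pos`, `siteAt` (the site of `Λ` at a position, if any), translation invariance of `eta` (`eta_sub`,
  `etaB_eq_eta_sub`), neighbour offsets (`sub_mem_nbrs0_of_adj`);
* the filtered neighbour lists of the tables have the expected shape: `children_spec` / `brothers_spec` (non-root
  geometries) and `childrenR_spec` / `brothersR_spec` (root geometries): length, no duplicates, membership;
* products over a set of sites covered by two / three optional sites (`prod_eq_optF_two/three`,
  `forall_iff_opt_two/three`), used to regroup the brother factors position by position;
* the table's integer factors as real numbers: `priorN = 10⁶·mP` (`mP` the pair-state prior at `p = 0.444`),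
  `childProb = 10⁶·cpsG`, the slot factors (`slotFactor_*_cast`), and the identification `lawB_eq_cpsG` of the law of
  a virtual-child read with `cpsG`.
-/

namespace Summit.CriticalPhenomena.PercolationContinuityZ3.Theorems.Pcint

namespace VdBEMarkov

open Finset AdaptDom VdBELocal Literature.Probability.LatticeModels

/-! ### Positions -/

/-- The position of a site of `ℤ²` as a pair of integers. -/
def pos (x : Site 2) : Pos := (x 0, x 1)

/-- `pos` is injective. -/
theorem pos_injective : Function.Injective pos := by
  intro x y h
  simp only [pos, Prod.mk.injEq] at h
  funext i; fin_cases i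
  · exact h.1
  · exact h.2

/-- `eta` is translation invariant. -/
theorem eta_sub (u v t : Pos) (su sv : PState) : eta (u - t) (v - t) su sv = eta u v su sv := by
  unfold eta
  have : (u - t).1 + (u - t).2 < (v - t).1 + (v - t).2 ↔ u.1 + u.2 < v.1 + v.2 := by
    simp only [Prod.fst_sub, Prod.snd_sub]; omega
  simp only [this]

/-- `etaB` in relative coordinates. -/
theorem etaB_eq_eta_sub (x y : Site 2) (t : Pos) (su sv : PState) :
    etaB x y su sv = eta (pos x - t) (pos y - t) su sv := by
  rw [eta_sub]; rfl

/-- The offset between lattice neighbours is one of the four unit vectors. -/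
theorem sub_mem_nbrs0_of_adj {x y : Site 2} (h : (zdGraph 2).Adj x y) : pos y - pos x ∈ nbrs (0, 0) := by
  have := WeakBeurling.coord_step_of_adj h
  simp only [nbrs, pos, List.mem_cons, List.mem_nil_iff, or_false, Prod.mk_sub_mk, Prod.mk.injEq, zero_add, zero_sub]
  omega

/-- Membership in `nbrs u` in terms of the offset. -/
theorem mem_nbrs_iff_sub (u π : Pos) : π ∈ nbrs u ↔ π - u ∈ nbrs (0, 0) := by
  obtain ⟨a, b⟩ := u; obtain ⟨x, y⟩ := π
  simp only [nbrs, List.mem_cons, List.mem_nil_iff, or_false, Prod.mk_sub_mk, Prod.mk.injEq, zero_add, zero_sub]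
  omega

variable {Λ : Finset (Site 2)}

/-- The site of `Λ` at a position, if any. -/
def siteAt (Λ : Finset (Site 2)) (π : Pos) : Option ↥Λ :=
  if h : (![π.1, π.2] : Site 2) ∈ Λ then some ⟨![π.1, π.2], h⟩ else none

/-- `siteAt π = some v` iff `v` sits at `π`. -/
theorem siteAt_eq_some_iff {π : Pos} {v : ↥Λ} : siteAt Λ π = some v ↔ pos v.1 = π := by
  unfold siteAt
  constructor
  · intro h
    split_ifs at h with hm
    rw [Option.some.injEq] at h
    rw [← h]; simp [pos]
  · intro h
    have hv : v.1 = ![π.1, π.2] := by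
      apply pos_injective; rw [h]; simp [pos]
    have hm : (![π.1, π.2] : Site 2) ∈ Λ := by rw [← hv]; exact v.2
    rw [dif_pos hm, Option.some.injEq]
    exact Subtype.ext hv.symm

/-- The site `v` sits at `pos v`. -/
theorem siteAt_pos (v : ↥Λ) : siteAt Λ (pos v.1) = some v := siteAt_eq_some_iff.2 rfl

/-- Distinct positions give distinct optional sites. -/
theorem siteAt_ne_of_ne {π π' : Pos} (h : π ≠ π') (v : ↥Λ) (hv : siteAt Λ π = some v) : siteAt Λ π' ≠ some v :=
  fun h' => h ((siteAt_eq_some_iff.1 hv).symm.trans (siteAt_eq_some_iff.1 h'))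

/-! ### The filtered neighbour lists of the tables -/

/-- A list of length three is the list of its first three entries. -/
theorem list_eq_three {l : List Pos} (h : l.length = 3) : l = [l.getD 0 (0, 0), l.getD 1 (0, 0), l.getD 2 (0, 0)] := by
  match l, h with
  | [a, b, c], _ => rfl

/-- A list of length two is the list of its first two entries. -/
theorem list_eq_two {l : List Pos} (h : l.length = 2) : l = [l.getD 0 (0, 0), l.getD 1 (0, 0)] := by
  match l, h with
  | [a, b], _ => rfl

/-- **Children offsets, non-root geometry**: for `cp ∈ nbrs 0`, the list `(nbrs 0).filter (· ≠ cp)` has three distinct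
entries. -/
theorem children_spec {cp : Pos} (hcp : cp ∈ nbrs (0, 0)) :
    ((nbrs (0, 0)).filter fun a => a ≠ cp).length = 3 ∧ ((nbrs (0, 0)).filter fun a => a ≠ cp).Nodup := by
  simp only [nbrs, List.mem_cons, List.mem_nil_iff, or_false, zero_add, zero_sub] at hcp
  rcases hcp with rfl | rfl | rfl | rfl <;> decide

/-- **Brother offsets, non-root geometry**: for `(cp, dp) ∈ geoms`, the list `(nbrs cp).filter (· ≠ 0 ∧ · ≠ dp)` has
two distinct entries. -/
theorem brothers_spec {cp dp : Pos} (h : (cp, dp) ∈ geoms) :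
    ((nbrs cp).filter fun b => b ≠ (0, 0) ∧ b ≠ dp).length = 2 ∧
      ((nbrs cp).filter fun b => b ≠ (0, 0) ∧ b ≠ dp).Nodup := by
  simp only [geoms, List.mem_cons, List.mem_nil_iff, or_false, Prod.mk.injEq] at h
  rcases h with ⟨rfl, rfl⟩ | ⟨rfl, rfl⟩ | ⟨rfl, rfl⟩ | ⟨rfl, rfl⟩ | ⟨rfl, rfl⟩ | ⟨rfl, rfl⟩ | ⟨rfl, rfl⟩ |
    ⟨rfl, rfl⟩ | ⟨rfl, rfl⟩ | ⟨rfl, rfl⟩ | ⟨rfl, rfl⟩ | ⟨rfl, rfl⟩ <;> decide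

/-- **Children offsets, root geometry**: for `b2p ∈ nbrs 0`, the list `(nbrs b2p).filter (· ≠ 0)` has three distinct
entries. -/
theorem childrenR_spec {b2p : Pos} (h : b2p ∈ nbrs (0, 0)) :
    ((nbrs b2p).filter fun a => a ≠ (0, 0)).length = 3 ∧ ((nbrs b2p).filter fun a => a ≠ (0, 0)).Nodup := by
  simp only [nbrs, List.mem_cons, List.mem_nil_iff, or_false, zero_add, zero_sub] at h
  rcases h with rfl | rfl | rfl | rfl <;> decide

/-- In a list of three distinct entries the entries are pairwise distinct. -/
theorem ne_of_nodup_three {a b c : Pos} (h : [a, b, c].Nodup) : a ≠ b ∧ a ≠ c ∧ b ≠ c := by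
  simp only [List.nodup_cons, List.mem_cons, or_false, not_or, List.not_mem_nil,
    not_false_eq_true, List.nodup_nil, and_true] at h
  exact ⟨h.1.1, h.1.2, h.2⟩

/-- In a list of two distinct entries the entries are distinct. -/
theorem ne_of_nodup_two {a b : Pos} (h : [a, b].Nodup) : a ≠ b := by
  simp only [List.nodup_cons, List.mem_cons, or_false, List.not_mem_nil, not_false_eq_true,
    List.nodup_nil, and_true] at h
  exact h

/-! ### Products over sites covered by two or three optional sites -/

/-- The factor of an optional site: `f b` if it is a site `b` of `T`, else `1`. -/
def optF {V : Type*} [DecidableEq V] (o : Option V) (T : Finset V) (f : V → ℝ) : ℝ :=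
  match o with
  | none => 1
  | some b => if b ∈ T then f b else 1

/-- A product over a set of sites covered by two distinct optional sites. -/
theorem prod_eq_optF_two {V : Type*} [DecidableEq V] {T : Finset V} (f : V → ℝ) (o₁ o₂ : Option V)
    (h12 : ∀ v, o₁ = some v → o₂ ≠ some v) (hT : ∀ b ∈ T, o₁ = some b ∨ o₂ = some b) :
    ∏ b ∈ T, f b = optF o₁ T f * optF o₂ T f := by
  classical
  -- a superset of `T` carrying the factors `if b ∈ T then f b else 1`
  have key : ∀ S : Finset V, T ⊆ S → ∏ b ∈ T, f b = ∏ b ∈ S, (if b ∈ T then f b else 1) := by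
    intro S hS
    rw [← Finset.prod_subset hS (f := fun b => if b ∈ T then f b else 1) (fun b _ hb => if_neg hb)]
    exact Finset.prod_congr rfl fun b hb => by rw [if_pos hb]
  rcases o₁ with _ | b₁ <;> rcases o₂ with _ | b₂
  · rw [key ∅ (fun b hb => by rcases hT b hb with h | h <;> cases h)]
    simp [optF]
  · have hsub : T ⊆ {b₂} := fun b hb => by
      rcases hT b hb with h | h
      · cases h
      · rw [Finset.mem_singleton]; exact (Option.some.inj h).symm
    rw [key {b₂} hsub, Finset.prod_singleton]
    simp only [optF, one_mul]
  · have hsub : T ⊆ {b₁} := fun b hb => by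
      rcases hT b hb with h | h
      · rw [Finset.mem_singleton]; exact (Option.some.inj h).symm
      · cases h
    rw [key {b₁} hsub, Finset.prod_singleton]
    simp only [optF, mul_one]
  · have hne : b₁ ≠ b₂ := fun h => h12 b₁ rfl (by rw [h])
    have hsub : T ⊆ {b₁, b₂} := fun b hb => by
      rw [Finset.mem_insert, Finset.mem_singleton]
      rcases hT b hb with h | h
      · exact Or.inl (Option.some.inj h).symm
      · exact Or.inr (Option.some.inj h).symm
    rw [key {b₁, b₂} hsub, Finset.prod_pair hne]
    simp only [optF]

/-- A product over a set of sites covered by three distinct optional sites. -/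
theorem prod_eq_optF_three {V : Type*} [DecidableEq V] {T : Finset V} (f : V → ℝ) (o₁ o₂ o₃ : Option V)
    (h12 : ∀ v, o₁ = some v → o₂ ≠ some v) (h13 : ∀ v, o₁ = some v → o₃ ≠ some v)
    (h23 : ∀ v, o₂ = some v → o₃ ≠ some v) (hT : ∀ b ∈ T, o₁ = some b ∨ o₂ = some b ∨ o₃ = some b) :
    ∏ b ∈ T, f b = optF o₁ T f * optF o₂ T f * optF o₃ T f := by
  classical
  -- split off the sites of `T` at `o₁`
  set T₁ := T.filter fun b => o₁ = some b with hT₁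
  set T' := T.filter fun b => ¬ o₁ = some b with hT'
  have hsplit : ∏ b ∈ T, f b = (∏ b ∈ T₁, f b) * ∏ b ∈ T', f b := (Finset.prod_filter_mul_prod_filter_not T _ f).symm
  have h1 : ∏ b ∈ T₁, f b = optF o₁ T f := by
    rcases o₁ with _ | b₁
    · have : T₁ = ∅ := by rw [hT₁]; ext b; simp
      rw [this]; simp [optF]
    · by_cases hb : b₁ ∈ T
      · have : T₁ = {b₁} := by
          rw [hT₁]; ext b; simp only [mem_filter, Option.some.injEq, mem_singleton]
          exact ⟨fun h => h.2.symm, fun h => ⟨h ▸ hb, h.symm⟩⟩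
        rw [this, Finset.prod_singleton]; simp [optF, hb]
      · have : T₁ = ∅ := by
          rw [hT₁, Finset.filter_eq_empty_iff]
          intro b hbT h'; exact hb ((Option.some.inj h') ▸ hbT)
        rw [this]; simp [optF, hb]
  have h2 : ∏ b ∈ T', f b = optF o₂ T f * optF o₃ T f := by
    rw [prod_eq_optF_two f o₂ o₃ h23 (fun b hb => by
      rw [hT', mem_filter] at hb
      rcases hT b hb.1 with h | h | h
      · exact absurd h hb.2
      · exact Or.inl h
      · exact Or.inr h)]
    -- `optF o T' f = optF o T f` for `o = o₂, o₃`
    have e : ∀ o : Option V, (∀ v, o₁ = some v → o ≠ some v) → optF o T' f = optF o T f := by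
      intro o ho
      rcases o with _ | b
      · rfl
      · simp only [optF, hT', mem_filter]
        by_cases hb : b ∈ T
        · have : ¬ o₁ = some b := fun h => ho b h rfl
          simp [hb, this]
        · simp [hb]
    rw [e o₂ h12, e o₃ h13]
  rw [hsplit, h1, h2, mul_assoc]

/-- A universal statement over a set of sites covered by two optional sites. -/
theorem forall_iff_opt_two {V : Type*} {T : Finset V} (P : V → Prop) (o₁ o₂ : Option V)
    (hT : ∀ b ∈ T, o₁ = some b ∨ o₂ = some b) :
    (∀ b ∈ T, P b) ↔ (∀ b, o₁ = some b → b ∈ T → P b) ∧ (∀ b, o₂ = some b → b ∈ T → P b) :=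
  ⟨fun h => ⟨fun b _ hb => h b hb, fun b _ hb => h b hb⟩,
    fun h b hb => (hT b hb).elim (fun h1 => h.1 b h1 hb) (fun h2 => h.2 b h2 hb)⟩

/-- A universal statement over a set of sites covered by three optional sites. -/
theorem forall_iff_opt_three {V : Type*} {T : Finset V} (P : V → Prop) (o₁ o₂ o₃ : Option V)
    (hT : ∀ b ∈ T, o₁ = some b ∨ o₂ = some b ∨ o₃ = some b) :
    (∀ b ∈ T, P b) ↔ (∀ b, o₁ = some b → b ∈ T → P b) ∧ (∀ b, o₂ = some b → b ∈ T → P b) ∧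
      (∀ b, o₃ = some b → b ∈ T → P b) :=
  ⟨fun h => ⟨fun b _ hb => h b hb, fun b _ hb => h b hb, fun b _ hb => h b hb⟩,
    fun h b hb => (hT b hb).elim (fun h1 => h.1 b h1 hb)
      (fun h' => h'.elim (fun h2 => h.2.1 b h2 hb) (fun h3 => h.2.2 b h3 hb))⟩

/-! ### The table's factors as real numbers -/

/-- The prior weight of a pair state at `p = 0.444`: `bern p b · bern p t`. -/
noncomputable def mP (s : PState) : ℝ := bern (444 / 1000) s.1 * bern (444 / 1000) s.2

/-- `priorN = 10⁶ · mP`. -/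
theorem priorN_cast (s : PState) : (priorN s : ℝ) = 10 ^ 6 * mP s := by
  obtain ⟨a, b⟩ := s
  cases a <;> cases b <;> norm_num [priorN, P, Q, mP, bern]

/-- `mP` is nonnegative. -/
theorem mP_nonneg (s : PState) : 0 ≤ mP s :=
  mul_nonneg (bern_nonneg (by norm_num) (by norm_num) _) (bern_nonneg (by norm_num) (by norm_num) _)

/-- `mP` has total mass `1`. -/
theorem sum_mP : ∑ s : PState, mP s = 1 := by
  simp only [Fintype.sum_prod_type, Fintype.sum_bool, mP, bern]; norm_num

/-- The semantic child probability: `P(η(a', b')(s, α) = b)` for a fresh pair state `s` at relative position `a'`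
(parent at `b'` in state `α`). -/
noncomputable def cpsG (a' b' : Pos) (α : PState) (b : Bool) : ℝ := ∑ s : PState, mP s * (if eta a' b' s α = b then 1 else 0)

/-- `childProb = 10⁶ · cpsG`. -/
theorem childProb_cast (a' b' : Pos) (α : PState) (b : Bool) : (childProb a' b' α b : ℝ) = 10 ^ 6 * cpsG a' b' α b := by
  rw [childProb_eq_sum]; unfold cpsG
  push_cast
  rw [Finset.mul_sum]
  exact Finset.sum_congr rfl fun s _ => by rw [priorN_cast]; ring

/-- `cpsG` is a probability vector. -/
theorem sum_cpsG (a' b' : Pos) (α : PState) : ∑ b, cpsG a' b' α b = 1 := by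
  unfold cpsG
  rw [Finset.sum_comm]
  have : ∀ s : PState, ∑ b : Bool, mP s * (if eta a' b' s α = b then (1 : ℝ) else 0) = mP s := by
    intro s; rw [Fintype.sum_bool]; cases eta a' b' s α <;> simp
  simp_rw [this]; exact sum_mP

/-- `cpsG` is nonnegative. -/
theorem cpsG_nonneg (a' b' : Pos) (α : PState) (b : Bool) : 0 ≤ cpsG a' b' α b :=
  Finset.sum_nonneg fun s _ => mul_nonneg (mP_nonneg s) (by split_ifs <;> norm_num)

/-- **The law of a virtual-child read is `cpsG`**: reading `η(a, b₂)(u a, α)` at the site `a` under the prior `mP` has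
the law `cpsG (pos a - t) (pos b₂ - t) α`. -/
theorem lawB_eq_cpsG (a b₂ : ↥Λ) (t : Pos) (α : PState) (b : Bool) :
    lawB (fun _ : ↥Λ => mP) (fun (v : ↥Λ) (s : PState) => etaB v.1 b₂.1 s α) (some a) b =
      cpsG (pos a.1 - t) (pos b₂.1 - t) α b := by
  simp only [lawB, cpsG]
  rw [Finset.sum_filter]
  exact Finset.sum_congr rfl fun s _ => by rw [etaB_eq_eta_sub a.1 b₂.1 t]; split_ifs <;> simp

/-- The `absent` slot factor is `1`. -/
theorem slotFactor_absent_cast (c' π : Pos) (γ : PState) : (slotFactor c' π γ Slot.absent : ℝ) = 1 := by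
  simp [slotFactor]

/-- The `succ β` slot factor is the indicator of `η(c', π)(γ, β)`. -/
theorem slotFactor_succ_cast (c' π : Pos) (γ β : PState) :
    (slotFactor c' π γ (Slot.succ β) : ℝ) = if eta c' π γ β then 1 else 0 := by
  simp [slotFactor]

/-- The `fail` slot factor is `10⁶ · Σ_β mP β · [¬ η(c', π)(γ, β)]`. -/
theorem slotFactor_fail_cast (c' π : Pos) (γ : PState) :
    (slotFactor c' π γ Slot.fail : ℝ) = 10 ^ 6 * ∑ β : PState, mP β * (if eta c' π γ β then 0 else 1) := by
  rw [slotFactor_fail_eq_sum]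
  push_cast
  rw [Finset.mul_sum]
  exact Finset.sum_congr rfl fun β _ => by rw [priorN_cast]; ring

end VdBEMarkov

end Summit.CriticalPhenomena.PercolationContinuityZ3.Theorems.Pcint
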